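import Summits.ABC.IUTFork.Repair.ObstructionSS32
import Summits.ABC.IUTFork.Repair.EvalHonestCeiling
import Summits.ABC.IUTFork.Repair.CandLana1
import Summits.ABC.IUTFork.Repair.CandMochizuki32
import HarnessLib

/-!
# IUT REPAIR — cross-checker: the §A «single-image» rows AT DOOR (b) (bed SCAL₀), and their (Ind)-BLIND ceilings (abc-iut-rp-cx gen 2)

Seat abc-iut-rp-cx (gen 2), rung LADDER-ABC:A2.RP; PROOF-ONLY (no `def`). Follow-up flagged «left UNTYPED» in the gen-0 sheet
HOME/plan/repair/cx/EVAL-SUMMARY.md §A: the column of the door-(b) bed of record SCAL₀ = `(sFull₀ p, wSetting p, wRho p, qDatum p)`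
(abc-iut-rp-s3 `Repair.ObstructionSS6Witness` / `ObstructionSS32.door_b_all_levels`: three pins, typed Thm. 3.11, `|log(q)| > 0`,
honest `j²`-volumes, the residual S, R3 at every label, the hull = the whole packet, Licence, `GapH3` ALL TRUE; `BridgeHyps`,
`ThetaFinite`, the typed Corollary FALSE — the non-isometric (Ind2) scalar of [cite: ScholzeStix2018, §2.2 p. 10]) for the rows of
§A that compare the q-pilot with ONE Kummer image or ONE possible image of the Θ-pilot.

FINDINGS (kernel, this file; cells BY NAME):
* §1 — (Ind)-BLIND CEILINGS. The KUMMER-IMAGE rows need no monotonicity, no admissibility of `thetaRegion3`, no Step (x) and no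
  finiteness to die: «every Kummer image `thetaRegion m` has log-volume EXACTLY `j²·qLocal`» at one label `j ≥ 2` with `qLocal < 0`
  already refutes RP-C01-VT (`volumeTransport_false_of_scaledImages`), RP-C01-QFC given (ii)(a) `KummerA` + `ThetaRegionsAdm`
  (`qFrobComparison_false_of_scaledImages`), and — with label-independent q and `AbsLogQPos` — RP-C01-GVT
  (`globalVolumeTransport_false_of_scaledImages`); RP-I17 = I4d′ is abc-iut-rp-d4's `CandInternal41Profile.not_hDegreeOrbitGe_of_scaled`
  (same shape). None of these clauses mentions the indeterminacy group: they hold verbatim at door (b).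
* §2 — THE SCAL₀ COLUMN. Kummer-image rows: X04a ✗ (`x04_false_wSetting`: `B_1 ⊄ B_4` at label 2), C01-VT ✗, C01-GVT ✗, C01-QFC ✗,
  I17 ✗ (I16 ✓ with `c = 1/PN(j²)`, d4's `hDegreeOrbit_of_scaled`). Possible-image rows: RP-L01 ✓ (`l01_holds_wSetting`), RP-M32a/b/c ✓
  (`m32_holds_wSetting`) — because at door (b) the q-pilot region IS a possible image (`ObstructionSS32.wSetting_reading3`).
* §3 — PACKAGE `scal_column_sectionA`: the whole column with the bed's interface census BY NAME.

READING for the census (neutral): the gen-0 class «§A = SAT+ EMPTY by theorem» splits at door (b). The rows reading KUMMER images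
(X04a, C01-VT/GVT/QFC, I17) are FALSE at BOTH doors — their load-bearing honest clause is exact `j²` on the Kummer images alone, an
(Ind)-blind datum; the rows reading POSSIBLE images with `=` (L01, M32b; and M32a = R3, M32c) are FALSE at door (a)'s honest beds and
TRUE at door (b) — so in `EvalHonestCeilingL01.l01_false_of_honestData` / `CandMochizuki32Tests.no_honest_model_of_H'` the clause that
door (b) removes is exactly Step (x) `LogvolInvariant` (isometric indeterminacies). No side taken on [IUTchIII] Cor. 3.12, on abc, or on
any author; candidates are hypotheses, never asserted; model data ≠ intended objects; typed ≠ proved.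
-/

noncomputable section

namespace Summit.ABC.IUTFork.Repair.EvalScalProfile

open Thm311 Cor312 Cor312Vol Literature.IUT.LogThetaLattice

/-! ## 1. (Ind)-blind ceilings for the Kummer-image rows -/

section General

variable {T : ThetaIndex} (S : LatticeSituation T) (P : Cor312.Setting S.toSituation)

/-- **RP-C01-VT dies on exact `j²` alone**: if at one label `j = i+1 ≥ 2` and one place EVERY Kummer image `thetaRegion m` has
log-volume `j²·qLocal` and `qLocal < 0` there, then `¬ VolumeTransport` — no monotonicity, admissibility, Step (x) or finiteness
used. [folklore] -/
theorem volumeTransport_false_of_scaledImages (i : Fin T.lstar) (hi : 1 ≤ (i : ℕ)) (vQ : T.VQ)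
    (hscaled : ∀ m : ℤ, (S.D P.n).logvol _ vQ (P.thetaRegion m (Setting.labelSucc i) vQ) =
      (((i : ℕ) + 1 : ℕ) : ℝ) ^ 2 * P.qLocal (Setting.labelSucc i) vQ)
    (hneg : P.qLocal (Setting.labelSucc i) vQ < 0) : ¬ VolumeTransport P := fun hvt => by
  obtain ⟨m, hm⟩ := hvt i vQ
  rw [hscaled m] at hm
  exact EvalHonestCeiling.not_le_jsq_mul_of_neg hneg hi hm

/-- **RP-C01-QFC dies on exact `j²` alone, given (ii)(a) `KummerA` and `ThetaRegionsAdm`** (the Frobenius-like readings of the two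
admissible regions ARE their mono-analytic log-volumes). [folklore] -/
theorem qFrobComparison_false_of_scaledImages (hKumA : (S.col P.n).KummerA (S.D P.n)) (hadm : ThetaRegionsAdm P)
    (i : Fin T.lstar) (hi : 1 ≤ (i : ℕ)) (vQ : T.VQ)
    (hscaled : ∀ m : ℤ, (S.D P.n).logvol _ vQ (P.thetaRegion m (Setting.labelSucc i) vQ) =
      (((i : ℕ) + 1 : ℕ) : ℝ) ^ 2 * P.qLocal (Setting.labelSucc i) vQ)
    (hneg : P.qLocal (Setting.labelSucc i) vQ < 0) : ¬ QFrobComparison P := fun h => by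
  obtain ⟨m, hm⟩ := h i vQ
  have hqA : (S.D P.n).Adm _ vQ (P.qRegion (Setting.labelSucc i) vQ) := P.hul_adm _ vQ _ (P.qRegion_mem _ vQ)
  rw [(hKumA m _ vQ _ hqA).2, (hKumA m _ vQ _ (hadm m i vQ)).2, hscaled m] at hm
  exact EvalHonestCeiling.not_le_jsq_mul_of_neg hneg hi hm

/-- **RP-C01-GVT dies on exact `j²` alone** (all Kummer images, all packets), with label-independent q-volume and `|log(q)| > 0`:
every global choice of Kummer images assembles to `PN(j²)·(−|log(q)|) < −|log(q)|`. [folklore] -/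
theorem globalVolumeTransport_false_of_scaledImages
    (hscaled : ∀ (m : ℤ) (i : Fin T.lstar) (vQ : T.VQ), (S.D P.n).logvol _ vQ (P.thetaRegion m (Setting.labelSucc i) vQ) =
      (((i : ℕ) + 1 : ℕ) : ℝ) ^ 2 * P.qLocal (Setting.labelSucc i) vQ)
    (hindep : ∀ (i i' : Fin T.lstar) (vQ : T.VQ), P.qLocal (Setting.labelSucc i) vQ = P.qLocal (Setting.labelSucc i') vQ)
    (hq : P.AbsLogQPos) : ¬ GlobalVolumeTransport P := by
  rintro ⟨m, -, hle⟩
  have hneg : P.negLogQ < 0 := hq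
  have hPN := CandInternal41Profile.five_halves_le_PN_labelSq (T := T)
  have h : (fun i : Fin T.lstar => ∑ᶠ vQ : T.VQ,
      (S.D P.n).logvol (Setting.labelSucc i) vQ (P.thetaRegion (m i vQ) (Setting.labelSucc i) vQ)) =
      fun i : Fin T.lstar => (((i : ℕ) + 1 : ℕ) : ℝ) ^ 2 * P.negLogQ := by
    funext i
    rw [show (fun vQ : T.VQ => (S.D P.n).logvol (Setting.labelSucc i) vQ (P.thetaRegion (m i vQ) (Setting.labelSucc i) vQ)) =
        fun vQ => (((i : ℕ) + 1 : ℕ) : ℝ) ^ 2 * P.qLocal (Setting.labelSucc i) vQ from funext fun vQ => hscaled _ i vQ,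
      ← mul_finsum' _ _ (qLocal_support_finite (P := P) (Setting.labelSucc i)), PinnedHonest.finsum_qLocal_eq_negLogQ S P hindep i]
  have h2 : processionNormalized (fun i : Fin T.lstar => (((i : ℕ) + 1 : ℕ) : ℝ) ^ 2 * P.negLogQ) =
      processionNormalized (fun i : Fin T.lstar => (((i : ℕ) + 1 : ℕ) : ℝ) ^ 2) * P.negLogQ := by
    unfold processionNormalized
    rw [← Finset.sum_mul, div_mul_eq_mul_div]
  rw [h, h2] at hle
  have h4 := mul_lt_mul_of_neg_right
    (show (1 : ℝ) < processionNormalized (fun i : Fin T.lstar => (((i : ℕ) + 1 : ℕ) : ℝ) ^ 2) by linarith) hneg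
  rw [one_mul] at h4
  exact absurd hle (not_le.2 h4)

end General

/-! ## 2. The SCAL₀ column (door (b) bed of record, abc-iut-rp-s3 / abc-iut-w4-d098) -/

section Scal

open Cor312.Checks Cor312.IdentifiedNonVacuity Cor312Vol.NaiveWitness Cor312Vol.UnitWitness Cor312Vol.PinnedWitness
  ScalarShells ScalarShellsThm311 ScalarShellsThm311Zero ObstructionSS6Witness ObstructionSS32

variable (p : ℕ) [hp : Fact p.Prime]

/-- **Every Kummer image is honestly scaled at SCAL₀**: `logvol(thetaRegion m) = j²·qLocal` at every label of `𝔽_l^⋇`, every `m`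
(the image is `B_{j²}`, the q-region `B_1`, `μ(B_k) = −k·log p`). [folklore] -/
theorem wSetting_thetaRegion_logvol (m : ℤ) (i : Fin toyIndex.lstar) (vQ : toyIndex.VQ) :
    ((sFull₀ p).D (wSetting p).n).logvol _ vQ ((wSetting p).thetaRegion m (Setting.labelSucc i) vQ) =
      (((i : ℕ) + 1 : ℕ) : ℝ) ^ 2 * (wSetting p).qLocal (Setting.labelSucc i) vQ := by
  rw [wSetting_thetaRegion_of_ne_zero p m (Setting.labelSucc_ne_zero i), wSetting_qLocal, ← jsq_labelSucc]
  show sVol p ⊤ _ vQ (sBall p ⊤ _ vQ _) = _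
  rw [sVol_sBall]
  ring

/-- The q-volume is label-independent at SCAL₀. [folklore] -/
theorem wSetting_qLocal_indep (i i' : Fin toyIndex.lstar) (vQ : toyIndex.VQ) :
    (wSetting p).qLocal (Setting.labelSucc i) vQ = (wSetting p).qLocal (Setting.labelSucc i') vQ := by
  rw [wSetting_qLocal, wSetting_qLocal]

/-- The q-volume is negative at every label of `𝔽_l^⋇` at SCAL₀. [folklore] -/
theorem wSetting_qLocal_neg (i : Fin toyIndex.lstar) (vQ : toyIndex.VQ) :
    (wSetting p).qLocal (Setting.labelSucc i) vQ < 0 := by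
  rw [wSetting_qLocal, neg_lt_zero]
  exact log_p_pos p

omit hp in
/-- Every Kummer image is admissible at SCAL₀ (a ball). [folklore] -/
theorem wSetting_thetaRegionsAdm : ThetaRegionsAdm (wSetting p) := fun m i vQ => by
  rw [wSetting_thetaRegion_of_ne_zero p m (Setting.labelSucc_ne_zero i)]
  exact sData₀_adm_sBall p _ vQ _

/-- **RP-X04a ✗ at SCAL₀**: at label `2` the q-region `B_1` is not inside the (Ind3)-enlarged Θ-region `B_4`. [folklore] -/
theorem x04_false_wSetting : ¬ CandExplicit4.H (sFull₀ p).toLatticeSituation (wSetting p) := fun h => by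
  have hj : (Setting.labelSucc (T := toyIndex) ⟨1, by decide⟩) ≠ 0 := Setting.labelSucc_ne_zero _
  have h2 := h (Setting.labelSucc ⟨1, by decide⟩) ()
  rw [wSetting_qRegion_of_ne_zero p hj, wSetting_thetaRegion3_of_ne_zero p hj, sBall_subset_iff] at h2
  have h3 : ((jsq (Setting.labelSucc (T := toyIndex) ⟨1, by decide⟩) : ℤ) : ℝ) ≤ 1 := by exact_mod_cast h2
  rw [jsq_labelSucc] at h3
  norm_num at h3

/-- **RP-C01-VT ✗ at SCAL₀** (§1 at label `2`). [folklore] -/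
theorem volumeTransport_false_wSetting : ¬ VolumeTransport (wSetting p) :=
  volumeTransport_false_of_scaledImages _ _ ⟨1, by decide⟩ le_rfl () (fun m => wSetting_thetaRegion_logvol p m _ ())
    (wSetting_qLocal_neg p _ ())

/-- **RP-C01-GVT ✗ at SCAL₀** (§1). [folklore] -/
theorem globalVolumeTransport_false_wSetting : ¬ GlobalVolumeTransport (wSetting p) :=
  globalVolumeTransport_false_of_scaledImages _ _ (wSetting_thetaRegion_logvol p) (wSetting_qLocal_indep p)
    (wSetting_absLogQPos p)

/-- **RP-C01-QFC ✗ at SCAL₀** (§1; (ii)(a) `KummerA` from the bed's typed Thm. 3.11 `sFull₀_statement`). [folklore] -/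
theorem qFrobComparison_false_wSetting : ¬ QFrobComparison (wSetting p) :=
  qFrobComparison_false_of_scaledImages _ _ ((sFull₀_statement p).2.1 (wSetting p).n).1 (wSetting_thetaRegionsAdm p)
    ⟨1, by decide⟩ le_rfl () (fun m => wSetting_thetaRegion_logvol p m _ ()) (wSetting_qLocal_neg p _ ())

omit hp in
/-- The Θ-side column volumes are finitely supported at SCAL₀ (one place). [folklore] -/
theorem wSetting_thetaAtFinite (m : ℤ) : CandInternal41.ThetaAtFinite (sFull₀ p).toLatticeSituation (wSetting p) m :=
  fun _ => Set.toFinite _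

/-- **RP-I16 ✓ at SCAL₀** (print's ℝ_{>0}-orbit reading, `c = 1/PN(j²)`; abc-iut-rp-d4's ∀-form BY NAME). [folklore] -/
theorem hDegreeOrbit_wSetting : CandInternal41.HDegreeOrbit (sFull₀ p).toLatticeSituation (wSetting p) :=
  CandInternal41Profile.hDegreeOrbit_of_scaled _ _ (wSetting_thetaAtFinite p) (wSetting_thetaRegion_logvol p)
    (wSetting_qLocal_indep p)

/-- **RP-I17 = I4d′ ✗ at SCAL₀** (`c ≥ 1` impossible; d4's ∀-form BY NAME). [folklore] -/
theorem not_hDegreeOrbitGe_wSetting : ¬ CandInternal41.HDegreeOrbitGe (sFull₀ p).toLatticeSituation (wSetting p) :=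
  CandInternal41Profile.not_hDegreeOrbitGe_of_scaled _ _ (wSetting_thetaRegion_logvol p) (wSetting_qLocal_indep p)
    (wSetting_absLogQPos p)

variable (ρ : (∀ v : toyIndex.V, v ∈ toyIndex.Vbad → Set ((scalingShells p).StarPacket v)) →
    ∀ (j : toyIndex.Label) (vQ : toyIndex.VQ), Set ((scalingShells p).Packet j vQ))
  (qK : ∀ v : toyIndex.V, v ∈ toyIndex.Vbad → Set ((scalingShells p).StarPacket v))

/-- **RP-L01 ✓ at SCAL₀** (for EVERY `ρ`, `qK`): the q-region is a possible image in every packet, so choosing it everywhere gives a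
global possible image of PN-log-volume EXACTLY `−|log(q)|` (`CandLana1.H_of_reading3`). Door (b) rescues the «=» global-volume row.
[folklore] -/
theorem l01_holds_wSetting : CandLana1.H (sFull₀ p).toLatticeSituation (wSetting p) ρ qK :=
  CandLana1.H_of_reading3 _ _ ρ qK fun _ vQ => wSetting_reading3 p _ vQ

/-- **RP-M32a ✓, RP-M32b ✓, RP-M32c ✓ at SCAL₀** (for EVERY `ρ`, `qK`): R3 at every label (`wSetting_reading3`) is M32a
(`CandMochizuki32.H_iff_reading3`), which gives the volume form M32b and the hull form M32c. [folklore] -/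
theorem m32_holds_wSetting :
    CandMochizuki32.H (sFull₀ p).toLatticeSituation (wSetting p) ρ qK ∧
      CandMochizuki32.H' (sFull₀ p).toLatticeSituation (wSetting p) ρ qK ∧
      CandMochizuki32.H'' (sFull₀ p).toLatticeSituation (wSetting p) ρ qK :=
  have h : CandMochizuki32.H (sFull₀ p).toLatticeSituation (wSetting p) ρ qK :=
    (CandMochizuki32.H_iff_reading3 _ _ ρ qK).2 fun j vQ => wSetting_reading3 p j vQ
  ⟨h, CandMochizuki32.H'_of_H _ _ ρ qK h, CandMochizuki32.H''_of_H _ _ ρ qK h⟩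

/-! ## 3. Package -/

/-- **THE SCAL₀ COLUMN OF §A, packaged with the bed's census BY NAME.** At the door-(b) pinned bed (typed Thm. 3.11, three pins,
`|log(q)| > 0`, S ✓, Licence ✓, `¬ BridgeHyps`, `¬ Statement`): the Kummer-image rows X04a, C01-VT, C01-GVT, C01-QFC, I17 are FALSE and
the possible-image rows L01, M32a/b/c are TRUE (I16 TRUE, insufficient as everywhere). [folklore] -/
theorem scal_column_sectionA :
    ((sFull₀ p).Statement ∧ PinnedRegions3 (sFull₀ p).toLatticeSituation (wSetting p) (wRho p) (qDatum p) ∧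
      (wSetting p).AbsLogQPos ∧ PilotKummerIndRelated (sFull₀ p).toLatticeSituation (wSetting p) (wRho p) (qDatum p) ∧
      Thm311ToCor312.Licence (wSetting p) ∧ ¬ BridgeHyps (wSetting p) ∧ ¬ (wSetting p).Statement) ∧
    (¬ CandExplicit4.H (sFull₀ p).toLatticeSituation (wSetting p) ∧ ¬ VolumeTransport (wSetting p) ∧
      ¬ GlobalVolumeTransport (wSetting p) ∧ ¬ QFrobComparison (wSetting p) ∧
      ¬ CandInternal41.HDegreeOrbitGe (sFull₀ p).toLatticeSituation (wSetting p)) ∧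
    (CandInternal41.HDegreeOrbit (sFull₀ p).toLatticeSituation (wSetting p) ∧
      CandLana1.H (sFull₀ p).toLatticeSituation (wSetting p) (wRho p) (qDatum p) ∧
      CandMochizuki32.H (sFull₀ p).toLatticeSituation (wSetting p) (wRho p) (qDatum p) ∧
      CandMochizuki32.H' (sFull₀ p).toLatticeSituation (wSetting p) (wRho p) (qDatum p) ∧
      CandMochizuki32.H'' (sFull₀ p).toLatticeSituation (wSetting p) (wRho p) (qDatum p)) := by
  obtain ⟨-, -, hS, -, -, -, -, hLic, -, hpins, hSt, hq, -, -, hnSt, hnB⟩ := door_b_all_levels p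
  exact ⟨⟨hSt, hpins, hq, hS, hLic, hnB, hnSt⟩,
    ⟨x04_false_wSetting p, volumeTransport_false_wSetting p, globalVolumeTransport_false_wSetting p,
      qFrobComparison_false_wSetting p, not_hDegreeOrbitGe_wSetting p⟩,
    ⟨hDegreeOrbit_wSetting p, l01_holds_wSetting p _ _, m32_holds_wSetting p _ _⟩⟩

end Scal

end Summit.ABC.IUTFork.Repair.EvalScalProfile

end
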